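import Summits.AtomisticToContinuum.HydrodynamicLimit.Theorems.TwoClocksTransferActivityTailsBlockAverageDock
import Summits.AtomisticToContinuum.HydrodynamicLimit.Theorems.TwoClocksTransferActivityTailsDriftEngineAvg
import Summits.AtomisticToContinuum.HydrodynamicLimit.Theorems.TwoClocksTransferActivityTailsDriftLLNEngine
import Summits.AtomisticToContinuum.HydrodynamicLimit.Theorems.TwoClocksTransferActivityTailsTaggedSumMeasurable
import HarnessLib

/-!
# `TransferActivityTails` (stmt-AtomisticToContinuum-16624) from a one-step predictor drift and one-block UI
# (line `Sketch`, card `predictor-drift-doob`: the drift engine's dock; sorry-free)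

Crux `Summit.AtomisticToContinuum.HydrodynamicLimit.Theses.TwoClocks.TransferActivityTails` (route TwoClocks, rank 7).
With the objects and posits of `TwoClocksTransferActivityTailsBlockAverageDock.lean` (`BlockAct`, (CD) `PredictorDrift τ₁`,
(UI₁) `OneBlockUI τ₁`, the dock `BlockAverageTails τ₁ ⟹ crux`), this file applies the landed abstract drift ⇒ LLN engine
(`TransferActivityTailsDriftLLNEngine.stub_driftLLNEngine`: truncation, Doob decomposition along `σ(X_{≤j})`, orthogonality of bounded
martingale increments, Markov/Chebyshev — `E[ā𝟙{ā > 4(C+1)/(1−ρ)}] ≤ M′(δ + (M² + Lm)/K) + δ′` on every probability space; its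
particle-averaged form `TransferActivityTailsDriftEngineAvg.stub_driftLLNEngineAvg`, p141539) to the measurable block variables
`X_{i,j} = 𝟙_good · BlockAct` (`TransferActivityTailsTaggedSumMeasurable.stub_collisionSumMeasurable`, p141436):

* `blockAverageTails_of_drift` — engine statement → `PredictorDrift τ₁` → `OneBlockUI τ₁` → `BlockAverageTails τ₁`
  (`σ₀ := min σ₀^CD σ₀^UI 1/2`, `V' := 4(C+1)/(1−ρ)`, three UI levels, `K₀ := ⌈max (L+1) (4M′(M²+Lm)/ε)⌉`, `N₀ := max`);
* `stub_driftReduction` — `(∃ τ₁ > 0, PredictorDrift τ₁ ∧ OneBlockUI τ₁) → TwoClocks.TransferActivityTails` (registered).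
So whoever proves (CD) ∧ (UI₁) at ONE block length closes the crux with a one-line file.  Lead
prover-line-stmt-AtomisticToContinuum-16624-c6-0; skeleton `Cruxes/TransferActivityTails/Lines/Sketch.lean`.
-/

noncomputable section

open MeasureTheory Set Filter Topology
open scoped ENNReal BigOperators

namespace Summit.AtomisticToContinuum.HydrodynamicLimit.Theorems.TransferActivityTailsDriftDock

open Literature.MathematicalPhysics.KineticTheory Literature.Analysis.FluidPDE
open Summit.AtomisticToContinuum.HydrodynamicLimit.Theorems.ClampedTransferCoin
  (Flow Phase Rec window impulse window_pos collisionSum_Ioc_add_Ioc)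
open Summit.AtomisticToContinuum.HydrodynamicLimit.Theorems.CollisionActivityTailsEndpointTails
  (tailFn tailFn_of_lt tailFn_of_le measurable_tailFn ae_mem_good_localGibbsLaw)
open Summit.AtomisticToContinuum.HydrodynamicLimit.Theorems.TransferActivityTailsBlockDrift
  (actSummand BlockAct InCruxFrame PredictorDrift OneBlockUI HeavyBlockPatternCost BlockAverageTails
   actSummand_nonneg blockAct_nonneg collisionSum_nonneg_of_nonneg stub_blockAverageDock)

/-- **Block-average tails from the drift engine and the two dynamical inputs** (engine statement as the first hypothesis,
verbatim the registered `stub_driftLLNEngine`; its particle-averaged form is the landed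
`TransferActivityTailsDriftEngineAvg.stub_driftLLNEngineAvg`).  `σ₀ := min σ₀^CD σ₀^UI 1/2` (measurability of the block
activity in the datum needs `σ < 1/2`: `TransferActivityTailsTaggedSumMeasurable.stub_collisionSumMeasurable`);
`V' := 4(C+1)/(1−ρ)`; given `ε`: levels `M′ (δ′ = ε/2)`, `M (δ = ε/(4(M′+1)))`, `M₁ (δ = 1)` from (UI₁), `m := M₁ + 1`,
`K₀ := ⌈max (L+1) (4M′(M² + Lm)/ε)⌉`; for `K ≥ K₀`, `N ≥ max N₀`: the averaged engine applied to `X_{i,j} = 𝟙_good · BlockAct`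
(measurable, equal to `BlockAct` a.e.) gives `E[(N+1)⁻¹Σ_i ā_i𝟙{ā_i > V'}] ≤ M′(δ + (M² + Lm)/K) + δ′ ≤ ε`. -/
theorem blockAverageTails_of_drift
    (hEng0 : ∀ (Ω : Type) [MeasurableSpace Ω] (P : Measure Ω) [IsProbabilityMeasure P] (K L : ℕ) (X : ℕ → Ω → ℝ)
        (ρ C M δ M' δ' m : ℝ),
        (∀ j, Measurable (X j)) → (∀ j ω, 0 ≤ X j ω) → 0 ≤ ρ → ρ < 1 → 0 ≤ C → 1 ≤ L → L < K →
        0 ≤ M → 0 ≤ δ → 0 ≤ M' → 0 ≤ δ' → 0 ≤ m →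
        (∀ j : ℕ, L ≤ j + 1 → j + 1 < K → ∀ g : (Fin (j + 1) → ℝ) → ℝ, Measurable g → (∀ y, 0 ≤ g y ∧ g y ≤ 1) →
          ∫⁻ ω, ENNReal.ofReal (X (j + 1) ω * g (fun k => X k ω)) ∂P ≤
          ∫⁻ ω, ENNReal.ofReal ((ρ * ((L : ℝ)⁻¹ * ∑ k ∈ Finset.range L, X (j + 1 - L + k) ω) + C) *
            g (fun k => X k ω)) ∂P) →
        (∑ j ∈ Finset.range K, ∫⁻ ω, ENNReal.ofReal (X j ω - M) ∂P ≤ ENNReal.ofReal (K * δ)) →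
        (∑ j ∈ Finset.range K, ∫⁻ ω, ENNReal.ofReal (X j ω - M') ∂P ≤ ENNReal.ofReal (K * δ')) →
        (∑ j ∈ Finset.range L, ∫⁻ ω, ENNReal.ofReal (X j ω) ∂P ≤ ENNReal.ofReal (L * m)) →
        ∫⁻ ω, ENNReal.ofReal (Set.indicator {y : ℝ | 4 * (C + 1) / (1 - ρ) < y} (fun y => y)
            ((K : ℝ)⁻¹ * ∑ j ∈ Finset.range K, X j ω)) ∂P ≤
          ENNReal.ofReal (M' * (δ + (M ^ 2 + L * m) / K) + δ'))
    {τ₁ : ℝ} (hτ₁ : 0 < τ₁) (hDrift : PredictorDrift τ₁) (hUI : OneBlockUI τ₁) : BlockAverageTails τ₁ := by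
  have hEng := TransferActivityTailsDriftEngineAvg.stub_driftLLNEngineAvg hEng0
  have hMeas := TransferActivityTailsTaggedSumMeasurable.stub_collisionSumMeasurable
  intro a₀ θ₀ u₀ ha hθ hu ha0 hθ0
  obtain ⟨σD, hσD, HD⟩ := hDrift a₀ θ₀ u₀ ha hθ hu ha0 hθ0
  obtain ⟨σU, hσU, HU⟩ := hUI a₀ θ₀ u₀ ha hθ hu ha0 hθ0
  refine ⟨min (min σD σU) 2⁻¹, lt_min (lt_min hσD hσU) (by norm_num), ?_⟩
  intro σ hσ hσlt T ρE θE uE hE Φ hlim t ht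
  have hσD' : σ < σD := hσlt.trans_le ((min_le_left _ _).trans (min_le_left _ _))
  have hσU' : σ < σU := hσlt.trans_le ((min_le_left _ _).trans (min_le_right _ _))
  have hσ2 : σ < 2⁻¹ := hσlt.trans_le (min_le_right _ _)
  have hσ2' : σ < 1 / 2 := by rw [one_div]; exact hσ2
  obtain ⟨ρ, C, L, hρ0, hρ1, hC, hL, QD⟩ := HD σ hσ hσD' T ρE θE uE hE Φ hlim t ht
  have QU := HU σ hσ hσU' T ρE θE uE hE Φ hlim t ht
  have h1ρ : 0 < 1 - ρ := by linarith
  -- the engine's level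
  set V' : ℝ := 4 * (C + 1) / (1 - ρ) with hV'
  have hV'pos : 0 < V' := by positivity
  refine ⟨V', hV'pos, ?_⟩
  intro ε hε
  -- the three UI levels
  obtain ⟨M', hM'0, HM'⟩ := QU (ε / 2) (by positivity)
  obtain ⟨M, hM0, HM⟩ := QU (ε / (4 * (M' + 1))) (by positivity)
  obtain ⟨M₁, hM₁0, HM₁⟩ := QU 1 one_pos
  set m : ℝ := M₁ + 1 with hm
  have hm0 : 0 ≤ m := by positivity
  -- the number of blocks
  set B : ℝ := 4 * M' * (M ^ 2 + L * m) / ε with hB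
  have hB0 : 0 ≤ B := by positivity
  set K₀ : ℕ := ⌈max ((L : ℝ) + 1) B⌉₊ with hK₀
  have hK₀L : (L : ℝ) + 1 ≤ K₀ := (le_max_left _ _).trans (Nat.le_ceil _)
  have hK₀B : B ≤ K₀ := (le_max_right _ _).trans (Nat.le_ceil _)
  have hK₀1 : 1 ≤ K₀ := by
    have : (1 : ℝ) ≤ K₀ := by linarith [(Nat.cast_nonneg L : (0 : ℝ) ≤ L)]
    exact_mod_cast this
  refine ⟨K₀, hK₀1, ?_⟩
  intro K hK₀K
  have hKreal : (K₀ : ℝ) ≤ K := Nat.cast_le.2 hK₀K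
  have hLK : L < K := by
    have : (L : ℝ) + 1 ≤ K := hK₀L.trans hKreal
    exact_mod_cast this
  have hK1 : 1 ≤ K := le_trans hL hLK.le
  have hKpos : (0 : ℝ) < K := by exact_mod_cast hK1
  -- the particle numbers
  obtain ⟨ND, HND⟩ := QD K hK1
  obtain ⟨NU', HNU'⟩ := HM' K hK1
  obtain ⟨NU, HNU⟩ := HM K hK1
  obtain ⟨NU₁, HNU₁⟩ := HM₁ K hK1
  refine ⟨max (max ND NU') (max NU NU₁), ?_⟩
  intro N hN s hs
  have hND : ND ≤ N := le_trans ((le_max_left _ _).trans (le_max_left _ _)) hN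
  have hNU' : NU' ≤ N := le_trans ((le_max_right _ _).trans (le_max_left _ _)) hN
  have hNU : NU ≤ N := le_trans ((le_max_left _ _).trans (le_max_right _ _)) hN
  have hNU₁ : NU₁ ≤ N := le_trans ((le_max_right _ _).trans (le_max_right _ _)) hN
  -- the law, the block variables
  set P := localGibbsLaw σ a₀ u₀ θ₀ N (Φ N) with hP
  haveI hPprob : IsProbabilityMeasure P :=
    isProbabilityMeasure_localGibbsLaw ha hθ hu ha0 hθ0 (by linarith : σ ≤ 1 / 2) N (Φ N)
  have hgood : ∀ᵐ z ∂P, z ∈ (Φ N).good := ae_mem_good_localGibbsLaw σ a₀ θ₀ u₀ N (Φ N)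
  set X : Fin (N + 1) → ℕ → Phase N → ℝ := fun i j => (Φ N).good.indicator (BlockAct σ τ₁ (Φ N) i j s)
    with hX
  have hXgood : ∀ {z : Phase N}, z ∈ (Φ N).good → ∀ i j, X i j z = BlockAct σ τ₁ (Φ N) i j s z :=
    fun hz i j => Set.indicator_of_mem hz _
  have hXmeas : ∀ i j, Measurable (X i j) := by
    intro i j
    have heq : X i j = fun z => σ / τ₁ * (Φ N).good.indicator (fun z =>
        (Φ N).collisionSum (Set.Ioc (s + j * window τ₁ N) (s + (j + 1) * window τ₁ N))
          (fun c => if c.fst = i then impulse c else 0) z) z := by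
      funext z
      exact Set.indicator_const_mul _ _ _ _
    rw [heq]
    exact (hMeas σ N (Φ N) i _ _ hσ hσ2').const_mul _
  have hXnn : ∀ i j z, 0 ≤ X i j z := fun i j z =>
    Set.indicator_nonneg (fun z _ => blockAct_nonneg hσ.le hτ₁.le (Φ N) i j s z) z
  -- (CD) for the block variables
  have hdriftX : ∀ i : Fin (N + 1), ∀ j : ℕ, L ≤ j + 1 → j + 1 < K → ∀ g : (Fin (j + 1) → ℝ) → ℝ, Measurable g →
      (∀ y, 0 ≤ g y ∧ g y ≤ 1) →
      ∫⁻ ω, ENNReal.ofReal (X i (j + 1) ω * g (fun k => X i k ω)) ∂P ≤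
      ∫⁻ ω, ENNReal.ofReal ((ρ * ((L : ℝ)⁻¹ * ∑ k ∈ Finset.range L, X i (j + 1 - L + k) ω) + C) *
        g (fun k => X i k ω)) ∂P := by
    intro i j hj1 hj2 g hg hg01
    have h := HND N hND s hs i j hj1 hj2 g hg hg01
    have hl : ∀ᵐ ω ∂P, ENNReal.ofReal (X i (j + 1) ω * g (fun k => X i k ω)) =
        ENNReal.ofReal (BlockAct σ τ₁ (Φ N) i (j + 1) s ω * g (fun k => BlockAct σ τ₁ (Φ N) i k s ω)) := by
      filter_upwards [hgood] with ω hω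
      simp only [hXgood hω]
    have hr : ∀ᵐ ω ∂P, ENNReal.ofReal ((ρ * ((L : ℝ)⁻¹ * ∑ k ∈ Finset.range L, X i (j + 1 - L + k) ω) + C) *
          g (fun k => X i k ω)) =
        ENNReal.ofReal ((ρ * ((L : ℝ)⁻¹ * ∑ k ∈ Finset.range L, BlockAct σ τ₁ (Φ N) i (j + 1 - L + k) s ω) + C) *
          g (fun k => BlockAct σ τ₁ (Φ N) i k s ω)) := by
      filter_upwards [hgood] with ω hω
      simp only [hXgood hω]
    rw [lintegral_congr_ae hl, lintegral_congr_ae hr]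
    exact h
  -- (UI₁) for the block variables, at the three levels
  have hoverX : ∀ (Mx δx : ℝ) (Nx : ℕ), Nx ≤ N →
      (∀ N : ℕ, Nx ≤ N → ∀ s ∈ Set.Icc 0 t, ∀ j : ℕ, j < K →
        ∫⁻ z, ENNReal.ofReal (((N : ℝ) + 1)⁻¹ * ∑ i : Fin (N + 1),
          max (BlockAct σ τ₁ (Φ N) i j s z - Mx) 0) ∂(localGibbsLaw σ a₀ u₀ θ₀ N (Φ N)) ≤ ENNReal.ofReal δx) →
      ∀ j, j < K → ∫⁻ ω, ENNReal.ofReal (((N + 1 : ℕ) : ℝ)⁻¹ * ∑ i, max (X i j ω - Mx) 0) ∂P ≤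
        ENNReal.ofReal δx := by
    intro Mx δx Nx hNx Hx j hj
    have h := Hx N hNx s hs j hj
    have hl : ∀ᵐ ω ∂P, ENNReal.ofReal (((N + 1 : ℕ) : ℝ)⁻¹ * ∑ i, max (X i j ω - Mx) 0) =
        ENNReal.ofReal (((N : ℝ) + 1)⁻¹ * ∑ i : Fin (N + 1), max (BlockAct σ τ₁ (Φ N) i j s ω - Mx) 0) := by
      filter_upwards [hgood] with ω hω
      simp only [hXgood hω, Nat.cast_succ]
    rw [lintegral_congr_ae hl]
    exact h
  have hover := hoverX M (ε / (4 * (M' + 1))) NU hNU HNU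
  have hover' := hoverX M' (ε / 2) NU' hNU' HNU'
  -- the mean of the first blocks: `E[(N+1)⁻¹ Σ_i X_{i,j}] ≤ M₁ + 1`
  have hmean : ∀ j, j < L → ∫⁻ ω, ENNReal.ofReal (((N + 1 : ℕ) : ℝ)⁻¹ * ∑ i, X i j ω) ∂P ≤ ENNReal.ofReal m := by
    intro j hj
    have hjK : j < K := lt_trans hj hLK
    have h1 := hoverX M₁ 1 NU₁ hNU₁ HNU₁ j hjK
    have hptw : ∀ ω, ENNReal.ofReal (((N + 1 : ℕ) : ℝ)⁻¹ * ∑ i, X i j ω) ≤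
        ENNReal.ofReal M₁ + ENNReal.ofReal (((N + 1 : ℕ) : ℝ)⁻¹ * ∑ i, max (X i j ω - M₁) 0) := by
      intro ω
      rw [← ENNReal.ofReal_add hM₁0 (mul_nonneg (inv_nonneg.2 (Nat.cast_nonneg _))
        (Finset.sum_nonneg fun i _ => le_max_right _ _))]
      refine ENNReal.ofReal_le_ofReal ?_
      have hn : (0 : ℝ) < ((N + 1 : ℕ) : ℝ) := by positivity
      have hle : ∑ i : Fin (N + 1), X i j ω ≤ ∑ i : Fin (N + 1), (M₁ + max (X i j ω - M₁) 0) :=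
        Finset.sum_le_sum fun i _ => by
          rcases le_total (X i j ω) M₁ with h | h
          · rw [max_eq_right (by linarith)]; linarith
          · rw [max_eq_left (by linarith)]; linarith
      rw [Finset.sum_add_distrib, Finset.sum_const, Finset.card_univ, Fintype.card_fin, nsmul_eq_mul] at hle
      calc ((N + 1 : ℕ) : ℝ)⁻¹ * ∑ i, X i j ω
          ≤ ((N + 1 : ℕ) : ℝ)⁻¹ * (((N + 1 : ℕ) : ℝ) * M₁ + ∑ i, max (X i j ω - M₁) 0) :=
            mul_le_mul_of_nonneg_left hle (inv_nonneg.2 hn.le)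
        _ = M₁ + ((N + 1 : ℕ) : ℝ)⁻¹ * ∑ i, max (X i j ω - M₁) 0 := by
            rw [mul_add, ← mul_assoc, inv_mul_cancel₀ hn.ne', one_mul]
    calc ∫⁻ ω, ENNReal.ofReal (((N + 1 : ℕ) : ℝ)⁻¹ * ∑ i, X i j ω) ∂P
        ≤ ∫⁻ ω, (ENNReal.ofReal M₁ + ENNReal.ofReal (((N + 1 : ℕ) : ℝ)⁻¹ * ∑ i, max (X i j ω - M₁) 0)) ∂P :=
          lintegral_mono hptw
      _ = ENNReal.ofReal M₁ + ∫⁻ ω, ENNReal.ofReal (((N + 1 : ℕ) : ℝ)⁻¹ * ∑ i, max (X i j ω - M₁) 0) ∂P := by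
          rw [lintegral_add_left measurable_const, lintegral_const, measure_univ, mul_one]
      _ ≤ ENNReal.ofReal M₁ + ENNReal.ofReal 1 := add_le_add le_rfl h1
      _ = ENNReal.ofReal m := by rw [hm, ENNReal.ofReal_add hM₁0 zero_le_one]
  -- THE ENGINE
  have hmain := hEng (Phase N) P (N + 1) K L X ρ C M (ε / (4 * (M' + 1))) M' (ε / 2) m (Nat.succ_pos N)
    hXmeas hXnn hρ0 hρ1 hC hL hLK hM0 (by positivity) hM'0 (by positivity) hm0 hdriftX hover hover' hmean
  -- the engine's bound is at most `ε`
  have hbound : M' * (ε / (4 * (M' + 1)) + (M ^ 2 + L * m) / K) + ε / 2 ≤ ε := by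
    have h1 : M' * (ε / (4 * (M' + 1))) ≤ ε / 4 := by
      rw [mul_div_assoc']
      rw [div_le_div_iff₀ (by positivity) (by norm_num : (0 : ℝ) < 4)]
      nlinarith
    have h2 : M' * ((M ^ 2 + L * m) / K) ≤ ε / 4 := by
      rw [mul_div_assoc', div_le_iff₀ hKpos]
      have : M' * (M ^ 2 + L * m) = ε / 4 * B := by rw [hB]; field_simp
      rw [this]
      exact mul_le_mul_of_nonneg_left (hK₀B.trans hKreal) (by positivity)
    nlinarith [mul_add M' (ε / (4 * (M' + 1))) ((M ^ 2 + L * m) / K)]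
  -- back from the measurable block variables to `BlockAct` (equal on the good set, a set of full measure)
  have hl : ∀ᵐ z ∂P, ENNReal.ofReal (((N : ℝ) + 1)⁻¹ * ∑ i : Fin (N + 1),
      tailFn V' ((K : ℝ)⁻¹ * ∑ j ∈ Finset.range K, BlockAct σ τ₁ (Φ N) i j s z)) =
      ENNReal.ofReal (((N + 1 : ℕ) : ℝ)⁻¹ * ∑ i, tailFn V' ((K : ℝ)⁻¹ * ∑ j ∈ Finset.range K, X i j z)) := by
    filter_upwards [hgood] with z hz
    simp only [hXgood hz, Nat.cast_succ]
  rw [lintegral_congr_ae hl]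
  exact hmain.trans (ENNReal.ofReal_le_ofReal hbound)

/-- **The crux from (CD) ∧ (UI₁) at one block length** (registered `stub_driftReduction`; the engine discharged by the landed
`TransferActivityTailsDriftLLNEngine.stub_driftLLNEngine`, the kinematics by the landed dock `stub_blockAverageDock`). -/
theorem stub_driftReduction : (∃ τ₁ : ℝ, 0 < τ₁ ∧ PredictorDrift τ₁ ∧ OneBlockUI τ₁) →
    Summit.AtomisticToContinuum.HydrodynamicLimit.Theses.TwoClocks.TransferActivityTails := by
  rintro ⟨τ₁, hτ₁, hD, hU⟩
  exact stub_blockAverageDock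
    ⟨τ₁, hτ₁, blockAverageTails_of_drift TransferActivityTailsDriftLLNEngine.stub_driftLLNEngine hτ₁ hD hU⟩

end Summit.AtomisticToContinuum.HydrodynamicLimit.Theorems.TransferActivityTailsDriftDock

end
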